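import Summits.AtomisticToContinuum.HydrodynamicLimit.Theorems.JParityClosureParityBandClosureStressIsotropyOfWindowCovarianceF
import HarnessLib

/-!
# Window-to-cone step of `ParityBandClosure` — helper H: the window fields over all windows

Support file for the stub `stub_stressIsotropyOfWindowCovariance` of the line `transfer-weighted-parity-chain`
(skeleton v4) of the crux `JParityClosure.ParityBandClosure` (stmt-AtomisticToContinuum-17608).

WHAT.  The tent-windowed cone fields `ρ_w, m_w, E_w` of `WindowCovarianceIsotropy` read along a measurable curve of
configurations with `ke ≤ K`, as functions of the WINDOW `(t₀, x) ∈ ℝ × 𝕋³`: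

* §1 joint measurability in `(t₀, x)` of a tent-windowed `(s, x)`-field (Fubini measurability of a parametric
  Bochner / Lebesgue integral), and of the increment integrands `‖m_r(s,x) − m_r(t₀,x)‖`, `|ρ_r(s,x) − ρ_r(t₀,x)|`
  in `((t₀, x), s)`;
* §2 uniform bounds: `|∫ w X| ≤ sup |X|` (window mass `≤ 1`), the window Cauchy–Schwarz bound
  `|m_w,j m_w,k / ρ_w| ≤ 6 (3/(πr³)) K` (helper A's weighted Cauchy–Schwarz with `mⱼ²/ρ ≤ 6 e_r`), whence
  `|C_w,jk| ≤ 8 (3/(πr³)) K` and the deviator bound `dev ≤ 144 (3/(πr³)) K`;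
* §3 consequently the functional of `WindowCovarianceIsotropy` with a bounded continuous nonnegative cut-off is a
  genuine integral: `∫⁻∫⁻ ofReal (g(σ³ρ_w) dev) = ofReal (∫∫ g(σ³ρ_w) dev)` (`lintegral_wci_eq_ofReal`).

REFERENCES.  Measure-theoretic glue; helpers A, F of this stub.
-/

noncomputable section

namespace Summit.AtomisticToContinuum.HydrodynamicLimit.Theorems.ParityBandClosureWindowToCone

open scoped BigOperators Topology Classical MeasureTheory ENNReal InnerProductSpace
open Filter Set MeasureTheory Function
open Literature.MathematicalPhysics.KineticTheory
open Literature.Analysis.FluidPDE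
open Literature.Analysis.FunctionSpaces
open Summit.AtomisticToContinuum.HydrodynamicLimit.Theorems.LocalSecondLawNegative
open Summit.AtomisticToContinuum.HydrodynamicLimit.Theorems.LocalSecondLawLedger
open Summit.AtomisticToContinuum.HydrodynamicLimit.Theorems.LocalSecondLawLedger.L
  (Mmom rhoC_eq_sum momC_apply_eq_sum momC_eq_sum norm_sq_eq_sum)
open Summit.AtomisticToContinuum.HydrodynamicLimit.Theorems.ChaosClosesEulerReduction
open Summit.AtomisticToContinuum.HydrodynamicLimit.Theorems.ChaosClosesEulerStressIsotropy
open Summit.AtomisticToContinuum.HydrodynamicLimit.Theorems.ChaosClosesEulerWindowedInvariance (tent_nonneg_le cone_nonneg_le)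

variable {N : ℕ}

/-! ## §1 Joint measurability in the window -/

/-- The tent weight `w(s − t₀)` is jointly measurable in `((t₀, x), s)`. [folklore] -/
theorem measurable_tent_pair (r : ℝ) :
    Measurable fun q : (ℝ × T3) × ℝ => (r ^ 2)⁻¹ * max (1 - |q.2 - q.1.1| / r ^ 2) 0 := by
  have h1 : Measurable fun q : (ℝ × T3) × ℝ => q.2 - q.1.1 := measurable_snd.sub measurable_fst.fst
  exact measurable_const.mul ((measurable_const.sub ((h1.abs).div_const _)).max measurable_const)

/-- Reading an `(s, x)`-field at `(s, x)` from `((t₀, x), s)`. [folklore] -/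
theorem measurable_read_sx {F : ℝ × T3 → ℝ} (hF : Measurable F) :
    Measurable fun q : (ℝ × T3) × ℝ => F (q.2, q.1.2) := by
  have h2 : Measurable fun q : (ℝ × T3) × ℝ => ((q.2, q.1.2) : ℝ × T3) := measurable_snd.prodMk measurable_fst.snd
  exact (Measurable.comp hF h2 :)

/-- **Fubini measurability of a tent-windowed field**: for a measurable `(s, x)`-field `F`,
`(t₀, x) ↦ ∫_{s ∈ [0,τ]} w(s − t₀) F(s, x) ds` is measurable. [folklore] -/
theorem measurable_tent_window (r τ : ℝ) {F : ℝ × T3 → ℝ} (hF : Measurable F) :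
    Measurable fun p : ℝ × T3 => ∫ s in Icc 0 τ, (r ^ 2)⁻¹ * max (1 - |s - p.1| / r ^ 2) 0 * F (s, p.2) := by
  have hG : Measurable fun q : (ℝ × T3) × ℝ => (r ^ 2)⁻¹ * max (1 - |q.2 - q.1.1| / r ^ 2) 0 * F (q.2, q.1.2) :=
    (measurable_tent_pair r).mul (measurable_read_sx hF)
  exact (hG.stronglyMeasurable.integral_prod_right' (ν := volume.restrict (Icc 0 τ))).measurable

/-- **Fubini measurability of a windowed Lebesgue integral**: for a measurable `H : ((t₀, x), s) ↦ ℝ`,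
`(t₀, x) ↦ ∫⁻_{s ∈ [0,τ]} ofReal (H((t₀,x), s))` is measurable. [folklore] -/
theorem measurable_window_lintegral (τ : ℝ) {H : (ℝ × T3) × ℝ → ℝ} (hH : Measurable H) :
    Measurable fun p : ℝ × T3 => ∫⁻ s in Icc 0 τ, ENNReal.ofReal (H (p, s)) :=
  (hH.ennreal_ofReal).lintegral_prod_right' (ν := volume.restrict (Icc 0 τ))

section Orbit

variable {γ : ℝ → Phase N} (hγ : Measurable γ) (r : ℝ)
include hγ

/-- The momentum increment `‖m_r(s,x) − m_r(t₀,x)‖` is jointly measurable in `((t₀, x), s)`. [folklore] -/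
theorem measurable_momC_increment :
    Measurable fun q : (ℝ × T3) × ℝ => ‖momC r (γ q.2) q.1.2 - momC r (γ q.1.1) q.1.2‖ := by
  have hm : Measurable (fun p : ℝ × T3 => momC r (γ p.1) p.2) := measurable_momC_orbit hγ r
  have h2 : Measurable fun q : (ℝ × T3) × ℝ => ((q.2, q.1.2) : ℝ × T3) := measurable_snd.prodMk measurable_fst.snd
  have ha : Measurable fun q : (ℝ × T3) × ℝ => momC r (γ q.2) q.1.2 := (Measurable.comp hm h2 :)
  have hb : Measurable fun q : (ℝ × T3) × ℝ => momC r (γ q.1.1) q.1.2 := (Measurable.comp hm measurable_fst :)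
  exact (ha.sub hb).norm

/-- The density increment `|ρ_r(s,x) − ρ_r(t₀,x)|` is jointly measurable in `((t₀, x), s)`. [folklore] -/
theorem measurable_rhoC_increment :
    Measurable fun q : (ℝ × T3) × ℝ => |rhoC r (γ q.2) q.1.2 - rhoC r (γ q.1.1) q.1.2| := by
  have hm : Measurable (fun p : ℝ × T3 => rhoC r (γ p.1) p.2) := measurable_rhoC_orbit hγ r
  have hb : Measurable fun q : (ℝ × T3) × ℝ => rhoC r (γ q.1.1) q.1.2 := (Measurable.comp hm measurable_fst :)
  exact ((measurable_read_sx hm).sub hb).abs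

/-- The window density `ρ_w(t₀, x)` is measurable in the window. [folklore] -/
theorem measurable_rhoW (τ : ℝ) :
    Measurable fun p : ℝ × T3 => ∫ s in Icc 0 τ, (r ^ 2)⁻¹ * max (1 - |s - p.1| / r ^ 2) 0 * rhoC r (γ s) p.2 :=
  measurable_tent_window r τ (F := fun q => rhoC r (γ q.1) q.2) (measurable_rhoC_orbit hγ r)

/-- The window moments `∫ w MpsiC ψ` are measurable in the window (measurable `ψ`). [folklore] -/
theorem measurable_MpsiCW (τ : ℝ) {ψ : V3 → ℝ} (hψ : Measurable ψ) :
    Measurable fun p : ℝ × T3 => ∫ s in Icc 0 τ, (r ^ 2)⁻¹ * max (1 - |s - p.1| / r ^ 2) 0 * MpsiC r (γ s) p.2 ψ :=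
  measurable_tent_window r τ (F := fun q => MpsiC r (γ q.1) q.2 ψ) (measurable_MpsiC_orbit hγ r hψ)

end Orbit

/-! ## §2 Uniform bounds of the window fields -/

/-- `|∫_{[0,τ]} w X| ≤ B` whenever `|X| ≤ B`: the window mass is at most one. [folklore] -/
theorem abs_window_integral_le {r : ℝ} (hr : 0 < r) (t₀ τ : ℝ) {X : ℝ → ℝ} {B : ℝ} (hB : ∀ s, |X s| ≤ B) :
    |∫ s in Icc 0 τ, (r ^ 2)⁻¹ * max (1 - |s - t₀| / r ^ 2) 0 * X s| ≤ B := by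
  have hh : 0 < r ^ 2 := by positivity
  have hB0 : 0 ≤ B := (abs_nonneg _).trans (hB 0)
  have hIw : Integrable (fun s => (r ^ 2)⁻¹ * max (1 - |s - t₀| / r ^ 2) 0 * B) (volume.restrict (Icc 0 τ)) :=
    ((integrable_tent_sub' hh t₀).mul_const B).integrableOn
  calc |∫ s in Icc 0 τ, (r ^ 2)⁻¹ * max (1 - |s - t₀| / r ^ 2) 0 * X s|
      ≤ ∫ s in Icc 0 τ, (r ^ 2)⁻¹ * max (1 - |s - t₀| / r ^ 2) 0 * B := by
        rw [← Real.norm_eq_abs]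
        refine norm_integral_le_of_norm_le hIw (ae_of_all _ fun s => ?_)
        rw [Real.norm_eq_abs, abs_mul, abs_of_nonneg (tent_nonneg_le hh _).1]
        exact mul_le_mul_of_nonneg_left (hB s) (tent_nonneg_le hh _).1
    _ = (∫ s in Icc 0 τ, (r ^ 2)⁻¹ * max (1 - |s - t₀| / r ^ 2) 0) * B := integral_mul_const _ _
    _ ≤ 1 * B := mul_le_mul_of_nonneg_right (window_mass_le_one hh t₀ _) hB0
    _ = B := one_mul B

/-- **The window Cauchy–Schwarz bound**: along a measurable curve with `ke ≤ K`,
`|m_w,j m_w,k / ρ_w| ≤ 6 (3/(πr³)) K` (junk branch `ρ_w = 0` included). [folklore] -/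
theorem abs_mw_mul_div_le {γ : ℝ → Phase N} (hγ : Measurable γ) {K : ℝ} (hK : ∀ s, ke (γ s) ≤ K)
    {r : ℝ} (hr : 0 < r) (t₀ τ : ℝ) (x : T3) (j k : Fin 3) :
    |(∫ s in Icc 0 τ, (r ^ 2)⁻¹ * max (1 - |s - t₀| / r ^ 2) 0 * MpsiC r (γ s) x (fun v => v j)) *
        (∫ s in Icc 0 τ, (r ^ 2)⁻¹ * max (1 - |s - t₀| / r ^ 2) 0 * MpsiC r (γ s) x (fun v => v k)) /
        (∫ s in Icc 0 τ, (r ^ 2)⁻¹ * max (1 - |s - t₀| / r ^ 2) 0 * rhoC r (γ s) x)| ≤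
      6 * (3 / (Real.pi * r ^ 3) * K) := by
  have hh : 0 < r ^ 2 := by positivity
  have hC : 0 ≤ 3 / (Real.pi * r ^ 3) := by positivity
  set w : ℝ → ℝ := fun s => (r ^ 2)⁻¹ * max (1 - |s - t₀| / r ^ 2) 0 with hwdef
  have hw0 : ∀ s, 0 ≤ w s := fun s => (tent_nonneg_le hh _).1
  set μ : Measure ℝ := volume.restrict (Icc 0 τ) with hμ
  set ρ : ℝ → ℝ := fun s => rhoC r (γ s) x with hρdef
  set m : Fin 3 → ℝ → ℝ := fun i s => MpsiC r (γ s) x (fun v => v i) with hmdef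
  have hmom : ∀ s i, momC r (γ s) x i = m i s := fun s i => momC_apply_eq_MpsiC r _ x i
  have hm0 : ∀ i s, ρ s = 0 → m i s = 0 := fun i s h => by rw [← hmom, momC_eq_zero_of_rhoC hr h]; simp
  have hρm : Measurable ρ := measurable_rhoC_curve hγ r x
  have hmm : ∀ i, Measurable (m i) := fun i => measurable_MpsiC_curve hγ r x (by fun_prop)
  have hρb : ∀ s, |ρ s| ≤ 3 / (Real.pi * r ^ 3) := fun s => by
    rw [abs_of_nonneg (rhoC_nonneg hr _ _)]; exact rhoC_le hr _ _
  have hmb : ∀ i s, |m i s| ≤ 3 / (Real.pi * r ^ 3) * (1 / 2 + K) := fun i s =>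
    (abs_MpsiC_coord_le hr _ x i).trans (mul_le_mul_of_nonneg_left (by linarith [hK s]) hC)
  -- the diagonal quotient `m_i²/ρ ≤ 6 e ≤ 6 (3/(πr³)) K`
  have hquot : ∀ i s, |m i s * m i s / ρ s| ≤ 6 * (3 / (Real.pi * r ^ 3) * K) := by
    intro i s
    rw [← hmom]
    have h1 := sum_abs_mm_div_le hr (γ s) x
    have h2 : |momC r (γ s) x i * momC r (γ s) x i / rhoC r (γ s) x| ≤
        ∑ i₁ : Fin 3, ∑ i₂ : Fin 3, |momC r (γ s) x i₁ * momC r (γ s) x i₂ / rhoC r (γ s) x| :=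
      (Finset.single_le_sum (f := fun i₂ => |momC r (γ s) x i * momC r (γ s) x i₂ / rhoC r (γ s) x|)
        (fun _ _ => abs_nonneg _) (Finset.mem_univ i)).trans
        (Finset.single_le_sum (f := fun i₁ => ∑ i₂ : Fin 3, |momC r (γ s) x i₁ * momC r (γ s) x i₂ / rhoC r (γ s) x|)
          (fun _ _ => Finset.sum_nonneg fun _ _ => abs_nonneg _) (Finset.mem_univ i))
    have h3 := (kinC_le_sup hr (γ s) x).2
    calc _ ≤ _ := h2
      _ ≤ 6 * kinC r (γ s) x := h1
      _ ≤ 6 * (3 / (Real.pi * r ^ 3) * K) :=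
          mul_le_mul_of_nonneg_left (h3.trans (mul_le_mul_of_nonneg_left (hK s) hC)) (by norm_num)
  -- weighted profiles and helper A's Cauchy–Schwarz
  have hRi : Integrable (fun s => w s * ρ s) μ := integrableOn_tent_mul hr t₀ τ hρm hρb
  have hMi : ∀ i, Integrable (fun s => w s * m i s) μ := fun i => integrableOn_tent_mul hr t₀ τ (hmm i) (hmb i)
  have hq_eq : ∀ i s, (w s * m i s) ^ 2 / (w s * ρ s) = w s * (m i s * m i s / ρ s) := by
    intro i s
    rcases (hw0 s).eq_or_lt with h | h
    · rw [← h]; simp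
    · by_cases hρ0 : ρ s = 0
      · rw [hρ0, hm0 i s hρ0]; simp
      · field_simp
  have hQi : ∀ i, Integrable (fun s => (w s * m i s) ^ 2 / (w s * ρ s)) μ := by
    intro i
    have e : (fun s => (w s * m i s) ^ 2 / (w s * ρ s)) = fun s => w s * (m i s * m i s / ρ s) := funext (hq_eq i)
    rw [e]
    exact integrableOn_tent_mul hr t₀ τ (((hmm i).mul (hmm i)).div hρm) (hquot i)
  have hCS : ∀ i, (∫ s, w s * m i s ∂μ) ^ 2 ≤ (∫ s, w s * ρ s ∂μ) * (6 * (3 / (Real.pi * r ^ 3) * K)) := by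
    intro i
    have h1 := sq_integral_le (μ := μ) (f := fun s => w s * m i s) (R := fun s => w s * ρ s)
      (fun s => mul_nonneg (hw0 s) (rhoC_nonneg hr _ _))
      (fun s hs => by
        rcases mul_eq_zero.1 hs with h | h
        · simp only [h, zero_mul]
        · simp only [hm0 i s h, mul_zero]) hRi (hMi i) (hQi i)
    refine h1.trans (mul_le_mul_of_nonneg_left ?_ (integral_nonneg fun s => mul_nonneg (hw0 s) (rhoC_nonneg hr _ _)))
    have e : (fun s => (w s * m i s) ^ 2 / (w s * ρ s)) = fun s => w s * (m i s * m i s / ρ s) := funext (hq_eq i)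
    rw [e]
    exact (le_abs_self _).trans (abs_window_integral_le hr t₀ τ (hquot i))
  -- conclude
  set a := ∫ s, w s * m j s ∂μ with ha
  set b := ∫ s, w s * m k s ∂μ with hb
  set R := ∫ s, w s * ρ s ∂μ with hR
  have hR0 : 0 ≤ R := integral_nonneg fun s => mul_nonneg (hw0 s) (rhoC_nonneg hr _ _)
  have hK0 : 0 ≤ K := (ke_nonneg _).trans (hK 0)
  by_cases hRz : R = 0
  · rw [hRz, div_zero, abs_zero]; positivity
  · have hRpos : 0 < R := lt_of_le_of_ne hR0 (Ne.symm hRz)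
    rw [abs_div, abs_of_pos hRpos, div_le_iff₀ hRpos]
    have h2 : 2 * |a * b| ≤ a ^ 2 + b ^ 2 := by
      rw [abs_mul]; nlinarith [sq_nonneg (|a| - |b|), sq_abs a, sq_abs b, abs_nonneg a, abs_nonneg b]
    nlinarith [hCS j, hCS k, h2]

/-- **Uniform bound of the window covariance entries**: `|C_w,jk| ≤ 8 (3/(πr³)) K`. [folklore] -/
theorem abs_Cw_le {γ : ℝ → Phase N} (hγ : Measurable γ) {K : ℝ} (hK : ∀ s, ke (γ s) ≤ K)
    {r : ℝ} (hr : 0 < r) (t₀ τ : ℝ) (x : T3) (j k : Fin 3) :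
    |(∫ s in Icc 0 τ, (r ^ 2)⁻¹ * max (1 - |s - t₀| / r ^ 2) 0 * MpsiC r (γ s) x (fun v => v j * v k)) -
        (∫ s in Icc 0 τ, (r ^ 2)⁻¹ * max (1 - |s - t₀| / r ^ 2) 0 * MpsiC r (γ s) x (fun v => v j)) *
        (∫ s in Icc 0 τ, (r ^ 2)⁻¹ * max (1 - |s - t₀| / r ^ 2) 0 * MpsiC r (γ s) x (fun v => v k)) /
        (∫ s in Icc 0 τ, (r ^ 2)⁻¹ * max (1 - |s - t₀| / r ^ 2) 0 * rhoC r (γ s) x)| ≤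
      8 * (3 / (Real.pi * r ^ 3) * K) := by
  have hC : 0 ≤ 3 / (Real.pi * r ^ 3) := by positivity
  have h1 : |∫ s in Icc 0 τ, (r ^ 2)⁻¹ * max (1 - |s - t₀| / r ^ 2) 0 * MpsiC r (γ s) x (fun v => v j * v k)| ≤
      3 / (Real.pi * r ^ 3) * (2 * K) :=
    abs_window_integral_le hr t₀ τ fun s =>
      (abs_MpsiC_quad_le hr _ x j k).trans (mul_le_mul_of_nonneg_left (by linarith [hK s]) hC)
  have h2 := abs_mw_mul_div_le hγ hK hr t₀ τ x j k
  refine (abs_sub _ _).trans ?_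
  linarith

/-- **Uniform bound of the window deviator**: `dev ≤ 144 (3/(πr³)) K`. [folklore] -/
theorem dev_le {γ : ℝ → Phase N} (hγ : Measurable γ) {K : ℝ} (hK : ∀ s, ke (γ s) ≤ K)
    {r : ℝ} (hr : 0 < r) (t₀ τ : ℝ) (x : T3) :
    ∑ j : Fin 3, ∑ k : Fin 3, |((∫ s in Icc 0 τ, (r ^ 2)⁻¹ * max (1 - |s - t₀| / r ^ 2) 0 * MpsiC r (γ s) x (fun v => v j * v k)) -
        (∫ s in Icc 0 τ, (r ^ 2)⁻¹ * max (1 - |s - t₀| / r ^ 2) 0 * MpsiC r (γ s) x (fun v => v j)) *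
        (∫ s in Icc 0 τ, (r ^ 2)⁻¹ * max (1 - |s - t₀| / r ^ 2) 0 * MpsiC r (γ s) x (fun v => v k)) /
        (∫ s in Icc 0 τ, (r ^ 2)⁻¹ * max (1 - |s - t₀| / r ^ 2) 0 * rhoC r (γ s) x)) -
      if j = k then (∑ l, ((∫ s in Icc 0 τ, (r ^ 2)⁻¹ * max (1 - |s - t₀| / r ^ 2) 0 * MpsiC r (γ s) x (fun v => v l * v l)) -
        (∫ s in Icc 0 τ, (r ^ 2)⁻¹ * max (1 - |s - t₀| / r ^ 2) 0 * MpsiC r (γ s) x (fun v => v l)) *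
        (∫ s in Icc 0 τ, (r ^ 2)⁻¹ * max (1 - |s - t₀| / r ^ 2) 0 * MpsiC r (γ s) x (fun v => v l)) /
        (∫ s in Icc 0 τ, (r ^ 2)⁻¹ * max (1 - |s - t₀| / r ^ 2) 0 * rhoC r (γ s) x))) / 3 else 0| ≤
      144 * (3 / (Real.pi * r ^ 3) * K) := by
  set C : Fin 3 → Fin 3 → ℝ := fun j k =>
    (∫ s in Icc 0 τ, (r ^ 2)⁻¹ * max (1 - |s - t₀| / r ^ 2) 0 * MpsiC r (γ s) x (fun v => v j * v k)) -
      (∫ s in Icc 0 τ, (r ^ 2)⁻¹ * max (1 - |s - t₀| / r ^ 2) 0 * MpsiC r (γ s) x (fun v => v j)) *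
      (∫ s in Icc 0 τ, (r ^ 2)⁻¹ * max (1 - |s - t₀| / r ^ 2) 0 * MpsiC r (γ s) x (fun v => v k)) /
      (∫ s in Icc 0 τ, (r ^ 2)⁻¹ * max (1 - |s - t₀| / r ^ 2) 0 * rhoC r (γ s) x) with hCdef
  have hB : ∀ j k, |C j k| ≤ 8 * (3 / (Real.pi * r ^ 3) * K) := fun j k => abs_Cw_le hγ hK hr t₀ τ x j k
  have hB0 : 0 ≤ 8 * (3 / (Real.pi * r ^ 3) * K) := (abs_nonneg _).trans (hB 0 0)
  have htr : |∑ l, C l l| ≤ 3 * (8 * (3 / (Real.pi * r ^ 3) * K)) :=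
    (Finset.abs_sum_le_sum_abs _ _).trans (le_of_le_of_eq (Finset.sum_le_sum fun l _ => hB l l) (by
      simp [Finset.sum_const, Finset.card_univ]))
  change ∑ j : Fin 3, ∑ k : Fin 3, |C j k - if j = k then (∑ l, C l l) / 3 else 0| ≤ 144 * (3 / (Real.pi * r ^ 3) * K)
  have hterm : ∀ j k : Fin 3, |C j k - if j = k then (∑ l, C l l) / 3 else 0| ≤ 2 * (8 * (3 / (Real.pi * r ^ 3) * K)) := by
    intro j k
    refine (abs_sub _ _).trans ?_
    split_ifs
    · rw [abs_div, abs_of_pos (by norm_num : (0 : ℝ) < 3)]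
      linarith [hB j k, htr]
    · rw [abs_zero]; linarith [hB j k]
  calc _ ≤ ∑ _j : Fin 3, ∑ _k : Fin 3, 2 * (8 * (3 / (Real.pi * r ^ 3) * K)) :=
        Finset.sum_le_sum fun j _ => Finset.sum_le_sum fun k _ => hterm j k
    _ = 144 * (3 / (Real.pi * r ^ 3) * K) := by simp [Finset.sum_const, Finset.card_univ]; ring

/-! ## §3 Genuine double integrals of bounded nonnegative measurable window functionals -/

/-- **A bounded nonnegative measurable window functional is a genuine double integral**:
`∫⁻_{t₀ ∈ [0,τ]} ∫⁻_x ofReal Ψ = ofReal (∫_{t₀ ∈ [0,τ]} ∫_x Ψ)`. [folklore] -/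
theorem lintegral_lintegral_eq_ofReal {Ψ : ℝ × T3 → ℝ} (hΨ : Measurable Ψ) (h0 : ∀ p, 0 ≤ Ψ p) {B : ℝ}
    (hB : ∀ p, Ψ p ≤ B) (τ : ℝ) :
    ∫⁻ t₀ in Icc 0 τ, ∫⁻ x, ENNReal.ofReal (Ψ (t₀, x)) = ENNReal.ofReal (∫ t₀ in Icc 0 τ, ∫ x, Ψ (t₀, x)) := by
  have hB0 : 0 ≤ B := (h0 (0, 0)).trans (hB (0, 0))
  -- the inner integral
  have hx : ∀ t₀, Integrable (fun x => Ψ (t₀, x)) volume := by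
    intro t₀
    have hm : Measurable fun x : T3 => Ψ (t₀, x) := (Measurable.comp hΨ (measurable_const.prodMk measurable_id) :)
    have h1 : IntegrableOn (fun x : T3 => Ψ (t₀, x)) Set.univ volume :=
      Measure.integrableOn_of_bounded (M := B) (measure_ne_top _ _) hm.aestronglyMeasurable
        (ae_of_all _ fun x => by rw [Real.norm_eq_abs, abs_of_nonneg (h0 _)]; exact hB _)
    rwa [integrableOn_univ] at h1
  have hinner : ∀ t₀, ∫⁻ x, ENNReal.ofReal (Ψ (t₀, x)) = ENNReal.ofReal (∫ x, Ψ (t₀, x)) := fun t₀ =>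
    (ofReal_integral_eq_lintegral_ofReal (hx t₀) (ae_of_all _ fun x => h0 _)).symm
  simp_rw [hinner]
  -- the outer integral
  have hmeas : Measurable fun t₀ => ∫ x, Ψ (t₀, x) :=
    (hΨ.stronglyMeasurable.integral_prod_right' (ν := (volume : Measure T3))).measurable
  have hnn : ∀ t₀, 0 ≤ ∫ x, Ψ (t₀, x) := fun t₀ => integral_nonneg fun x => h0 _
  have hbd : ∀ t₀, ∫ x, Ψ (t₀, x) ≤ B * (volume : Measure T3).real Set.univ := fun t₀ => by
    have h1 := integral_mono (hx t₀) (integrable_const B) fun x => hB (t₀, x)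
    rwa [integral_const, smul_eq_mul, mul_comm] at h1
  have hI : IntegrableOn (fun t₀ => ∫ x, Ψ (t₀, x)) (Icc 0 τ) volume :=
    Measure.integrableOn_of_bounded (M := B * (volume : Measure T3).real Set.univ)
      (by rw [Real.volume_Icc]; exact ENNReal.ofReal_ne_top) hmeas.aestronglyMeasurable
      (ae_of_all _ fun t₀ => by rw [Real.norm_eq_abs, abs_of_nonneg (hnn t₀)]; exact hbd t₀)
  exact (ofReal_integral_eq_lintegral_ofReal hI (ae_of_all _ fun t₀ => hnn t₀)).symm

/-- **A bounded nonnegative measurable window functional over a sub-window of `[0, τ]`**: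
`∫⁻_{t₀ ∈ I} ∫⁻_x ofReal Ψ ≤ ofReal (∫_{t₀ ∈ [0,τ]} ∫_x Ψ)` for `I ⊆ [0, τ]`. [folklore] -/
theorem lintegral_lintegral_le_ofReal {Ψ : ℝ × T3 → ℝ} (hΨ : Measurable Ψ) (h0 : ∀ p, 0 ≤ Ψ p) {B : ℝ}
    (hB : ∀ p, Ψ p ≤ B) {τ : ℝ} {I : Set ℝ} (hI : I ⊆ Icc 0 τ) :
    ∫⁻ t₀ in I, ∫⁻ x, ENNReal.ofReal (Ψ (t₀, x)) ≤ ENNReal.ofReal (∫ t₀ in Icc 0 τ, ∫ x, Ψ (t₀, x)) := by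
  rw [← lintegral_lintegral_eq_ofReal hΨ h0 hB τ]
  exact lintegral_mono_set hI

/-! ## §4 Registered sub-goal -/

/-- **Registered sub-goal `stub_stressIsotropyOfWindowCovarianceH` (helper H of
`stub_stressIsotropyOfWindowCovariance`): tent windows have mass at most one** — `|∫_{[0,τ]} bt(s − t₀) X(s) ds| ≤ B`
whenever `|X| ≤ B`, the source of every uniform bound of the window fields. [folklore] -/
theorem stub_stressIsotropyOfWindowCovarianceH : ∀ {r : ℝ}, 0 < r → ∀ (t₀ τ : ℝ) {X : ℝ → ℝ} {B : ℝ}, (∀ s, |X s| ≤ B) → |∫ s in Set.Icc 0 τ, (r ^ 2)⁻¹ * max (1 - |s - t₀| / r ^ 2) 0 * X s| ≤ B :=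
  fun hr t₀ τ _ _ hB => abs_window_integral_le hr t₀ τ hB

end Summit.AtomisticToContinuum.HydrodynamicLimit.Theorems.ParityBandClosureWindowToCone

end
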